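import Summits.BirchSwinnertonDyer.Rank1Residual.P2.CongruentNumberPairsAtTwoEvenAtlasThreeTransfer
import HarnessLib
import HarnessLib.Audit.Tags

/-!
# Cell «bsd-monsky» (prover-B): Rédei kernels UNIFORM IN THE NUMBER OF PRIMES — the «star» configurations
# (`q ≡ 3`; `p₁, …, p_m ≡ 5 (mod 8)` pairwise quadratic residues, at most one `pᵢ` a non-residue mod `q`):
# `g(2qp₁⋯p_m)` is ODD and `g` of every even block of the `pᵢ` is EVEN, for EVERY `m` (kernel lemmas; nothing asserted)

HONEST FRAMING (cell `bsd-monsky`, run/shared/lean/pub/bsd-monsky/; README §1/§3): the cell's CLAIMED theorem is Monsky's 1990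
conjecture on the `k = 2` family `𝒮⁻`; «ℓ ≥ 3 rungs are NOT claimed — record what the same argument gives there, no more». THIS FILE
is `𝔽₂`-linear algebra ONLY: the Rédei-kernel bits `gBitCfgTwo` / `gBitCfg` of the sub-lane's configuration calculus
(`P2/CongruentNumberPairsAtTwoEvenAtlasThreeCensus.lean`, `P2/CongruentClassSevenConfigurations.lean`) evaluated on configurations of
ARBITRARY size — so far every instance in the tree was a `decide` on `t ≤ 4` symbol patterns. The point: route B's `θ`-criterion
(`P2/CongruentNumberThetaCriterion.lean`) decides a family of square-free `n ≡ 6 (mod 8)` with ANY number of prime factors once the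
relevant `g`-parities are known in closed form, and for the «star» configurations they are (companion `…ThetaStarFamily.lean`).

THE CONFIGURATIONS. Residues `r = (3, 5, …, 5)` on `Fin (m+1)` (the prime `q ≡ 3` first, then `p₁, …, p_m ≡ 5 (mod 8)`) and symbol
bits `β` with `β 0 i⁺ = β i⁺ 0 = μ i` (`μ i = [(pᵢ/q) = −1]`; the two directions agree by reciprocity, `pᵢ ≡ 1 (mod 4)`) and
`β i⁺ j⁺ = 0` for `i ≠ j` (the `pᵢ` are pairwise quadratic residues); AT MOST ONE mark `μ i = 1`.
* `gBitCfgTwo_star_eq_one`: the Rédei matrix `RM(−8·q·∏pᵢ)` (Li–Ma: row/column of `2` all ones since every residue is `±3 (mod 8)`,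
  `q`–`pᵢ` entries `μ i`, `pᵢ`–`pⱼ` entries `0`) has kernel `{0, 𝟙}` — `g(2q∏pᵢ) = #2Cl(ℚ(√−2q∏pᵢ))` is ODD — for every `m ≥ 0`.
* `gBitCfg_fiveClique_eq_zero`: for `m ≥ 2` primes `≡ 5 (mod 8)`, pairwise residues, `RM(−4∏pᵢ)` has the odd rows zero and the
  row of `2` all ones: kernel of dimension `m ≥ 2`, so `g(∏pᵢ)` is EVEN (an ideal class of order `4` exists).
Both through three general «row-sum matrix» lemmas (`rowsum_mulVec_apply`: `(Mv)_a = Σ_b f(a,b)(v_a + v_b)`; a row-sum matrix kills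
the constants; `#ker = 2` iff every kernel vector is constant; a non-constant kernel vector forces `#ker ≠ 2`). No `decide`, no
definition, nothing asserted; NOT refereed, not part of PROOF-B v1.3 or of the paper.

References: [LiMa2008] Lemma 0.1, Def. 0.2 (p. 279), Thm. 0.4 (p. 280); [Stevenhagen1995RedeiMatrices] §2 Thm. 1;
[IrelandRosen1990] Ch. 5 §1 Prop. 5.1.2–5.1.3, §2 Thm. 1; HOME/proof/PROOF-B-THETA-STAR.md (this generation's companion note).
-/

noncomputable section

open scoped Classical

open Matrix Finset Literature.NumberTheory.QuadraticFields.RedeiReichardt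

set_option autoImplicit false

namespace Summit.BirchSwinnertonDyer.Rank1Residual.P2

namespace ThetaDescent

/-! ## §1 Row-sum matrices over `𝔽₂`: `(Mv)_a = Σ_b f(a,b)·(v_a + v_b)` and the kernel count -/

section RowSum

variable {ι : Type*} [Fintype ι] [DecidableEq ι]

/-- For a «row-sum» matrix `M = (f(a,b))` off the diagonal, `M_aa = Σ_{c ≠ a} f(a,c)` (Li–Ma's Rédei matrices, Monsky's `A`):
`(Mv)_a = Σ_b f(a,b)·(v_a + v_b)` over `𝔽₂` (the diagonal term vanishes since `v_a + v_a = 0`).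
[cite: LiMa2008, Def. 0.2 (p. 279: r_ii = Σ_{j ≠ i} r_ij)] -/
theorem rowsum_mulVec_apply (f : ι → ι → ZMod 2) (v : ι → ZMod 2) (a : ι) :
    ((Matrix.of fun a b => if a = b then ∑ c ∈ univ.erase a, f a c else f a b) *ᵥ v) a =
      ∑ b, f a b * (v a + v b) := by
  have hdiag : ∀ b, (Matrix.of fun a b => if a = b then ∑ c ∈ univ.erase a, f a c else f a b) a b * v b =
      if a = b then (∑ c ∈ univ.erase a, f a c) * v a else f a b * v b := by
    intro b
    rw [Matrix.of_apply]
    split_ifs with h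
    · subst h; rfl
    · rfl
  simp only [Matrix.mulVec, dotProduct, hdiag]
  rw [Finset.sum_ite, Finset.filter_eq, if_pos (mem_univ a), Finset.sum_singleton, Finset.filter_ne]
  symm
  rw [← Finset.add_sum_erase _ _ (mem_univ a), CharTwo.add_self_eq_zero, mul_zero, zero_add]
  simp only [mul_add, Finset.sum_add_distrib, Finset.sum_mul]

/-- Kernel membership of a row-sum matrix, coordinatewise. [cite: LiMa2008, Def. 0.2 (p. 279)] -/
theorem rowsum_mulVec_eq_zero_iff (f : ι → ι → ZMod 2) (v : ι → ZMod 2) :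
    (Matrix.of fun a b => if a = b then ∑ c ∈ univ.erase a, f a c else f a b) *ᵥ v = 0 ↔
      ∀ a, ∑ b, f a b * (v a + v b) = 0 := by
  constructor
  · intro h a
    rw [← rowsum_mulVec_apply f v a, h, Pi.zero_apply]
  · intro h
    funext a
    rw [rowsum_mulVec_apply, Pi.zero_apply]
    exact h a

/-- A row-sum matrix kills the constant vectors («a singular matrix since the sum of its rows is zero»).
[cite: Stevenhagen1995RedeiMatrices, §2 (after Thm. 1)] -/
theorem rowsum_mulVec_const (f : ι → ι → ZMod 2) (c : ZMod 2) :
    (Matrix.of fun a b => if a = b then ∑ c ∈ univ.erase a, f a c else f a b) *ᵥ (fun _ => c) = 0 := by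
  rw [rowsum_mulVec_eq_zero_iff]
  intro a
  refine Finset.sum_eq_zero fun b _ => ?_
  rw [CharTwo.add_self_eq_zero, mul_zero]

/-- **Kernel count `2`**: if every kernel vector of a row-sum matrix on a nonempty index set is CONSTANT, the kernel is `{0, 𝟙}`
(Rédei–Reichardt: `4`-rank `0`, i.e. `g` odd). [cite: LiMa2008, Thm. 0.4 (p. 280)] [cite: Stevenhagen1995RedeiMatrices, §2 Thm. 1] -/
theorem card_ker_rowsum_eq_two [Nonempty ι] (f : ι → ι → ZMod 2)
    (h : ∀ v : ι → ZMod 2, (∀ a, ∑ b, f a b * (v a + v b) = 0) → ∀ a b, v a = v b) :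
    Fintype.card {v : ι → ZMod 2 //
      (Matrix.of fun a b => if a = b then ∑ c ∈ univ.erase a, f a c else f a b) *ᵥ v = 0} = 2 := by
  obtain ⟨a₀⟩ := (inferInstance : Nonempty ι)
  rw [Fintype.card_of_subtype ({0, fun _ => 1} : Finset (ι → ZMod 2)) ?_]
  · refine Finset.card_pair fun h01 => ?_
    exact zero_ne_one (congr_fun h01 a₀)
  · intro v
    rw [Finset.mem_insert, Finset.mem_singleton]
    constructor
    · rintro (rfl | rfl)
      · exact Matrix.mulVec_zero _
      · exact rowsum_mulVec_const f 1
    · intro hv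
      have hc := h v ((rowsum_mulVec_eq_zero_iff f v).mp hv)
      rcases (by decide : ∀ c : ZMod 2, c = 0 ∨ c = 1) (v a₀) with h0 | h1
      · left
        funext b
        rw [hc b a₀, h0, Pi.zero_apply]
      · right
        funext b
        rw [hc b a₀, h1]

/-- **Kernel count `≠ 2`**: a NON-CONSTANT kernel vector of a row-sum matrix gives three kernel vectors `0, 𝟙, v`
(Rédei–Reichardt: `4`-rank `≥ 1`, i.e. `g` even). [cite: LiMa2008, Thm. 0.4 (p. 280)] [cite: Stevenhagen1995RedeiMatrices, §2 Thm. 1] -/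
theorem card_ker_rowsum_ne_two (f : ι → ι → ZMod 2) (v : ι → ZMod 2)
    (hv : ∀ a, ∑ b, f a b * (v a + v b) = 0) {a b : ι} (hab : v a ≠ v b) :
    Fintype.card {v : ι → ZMod 2 //
      (Matrix.of fun a b => if a = b then ∑ c ∈ univ.erase a, f a c else f a b) *ᵥ v = 0} ≠ 2 := by
  have hv0 : v ≠ 0 := fun h => hab (by rw [h]; rfl)
  have hv1 : v ≠ fun _ => 1 := fun h => hab (by rw [h])
  have h01 : (0 : ι → ZMod 2) ≠ fun _ => 1 := fun h => zero_ne_one (congr_fun h a)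
  intro h2
  have hsub : ({0, (fun _ => (1 : ZMod 2)), v} : Finset (ι → ZMod 2)) ⊆
      univ.filter fun w : ι → ZMod 2 =>
        (Matrix.of fun a b => if a = b then ∑ c ∈ univ.erase a, f a c else f a b) *ᵥ w = 0 := by
    intro w hw
    rw [Finset.mem_filter]
    refine ⟨mem_univ _, ?_⟩
    rw [Finset.mem_insert, Finset.mem_insert, Finset.mem_singleton] at hw
    rcases hw with rfl | rfl | rfl
    · exact Matrix.mulVec_zero _
    · exact rowsum_mulVec_const f 1
    · exact (rowsum_mulVec_eq_zero_iff f _).mpr hv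
  have h3 : ({0, (fun _ => (1 : ZMod 2)), v} : Finset (ι → ZMod 2)).card = 3 := by
    rw [Finset.card_insert_of_notMem, Finset.card_pair hv1.symm]
    rw [Finset.mem_insert, Finset.mem_singleton, not_or]
    exact ⟨h01, hv0.symm⟩
  have hle := Finset.card_le_card hsub
  rw [h3, ← Fintype.card_subtype, h2] at hle
  omega

end RowSum

/-! ## §2 The «star» configuration: `g(2·q·p₁⋯p_m)` is ODD for every `m` (at most one `pᵢ` a non-residue mod `q`) -/

section Star

variable {m : ℕ}

/-- `∏ rᵢ ≡ 3 (mod 4)` for the residue vector `(3, 5, …, 5)`. [cite: HardyWright2008, §5.2 (residues)] -/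
theorem prod_star_residues_mod_four (r : Fin (m + 1) → ℕ) (hr0 : r 0 = 3) (hrs : ∀ i : Fin m, r i.succ = 5) :
    (∏ i, r i) % 4 = 3 := by
  rw [Fin.prod_univ_succ, hr0]
  have h5 : ∏ i : Fin m, r i.succ = 5 ^ m := by
    rw [Finset.prod_congr rfl fun i _ => hrs i, Fin.prod_const]
  rw [h5, Nat.mul_mod, Nat.pow_mod]
  norm_num

/-- **`g(2·q·p₁⋯p_m)` is ODD on the star configuration, for every `m ≥ 0`.** Residues `(3, 5, …, 5)`; bits `β 0 i⁺ = β i⁺ 0 = μ i`,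
`β i⁺ j⁺ = 0` (`i ≠ j`); at most one `μ i = 1`. The Rédei matrix `RM(−8q∏pᵢ)` read on the configuration (`redeiCfgTwo`: the row and
the column of the prime `2` are all ones since every residue is `±3 (mod 8)`; `D₂ = 8` as `q∏pᵢ ≡ 3 (mod 4)`) has kernel `{0, 𝟙}`:
the row of an unmarked `pᵢ` reads `v_i + v_2 = 0`, the row of the marked `p_a` reads `v_2 + v_q = 0`, the row of `q` then gives
`v_a = v_q`. So `gBitCfgTwo = 1`, i.e. `#2Cl(ℚ(√−2q∏pᵢ))` odd (modulo Rédei–Reichardt, applied in the companion file).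
[cite: LiMa2008, Thm. 0.4 (p. 280) with Lemma 0.1, Def. 0.2 (p. 279)] [cite: Stevenhagen1995RedeiMatrices, §2 Thm. 1 (l = 2)] -/
theorem gBitCfgTwo_star_eq_one (r : Fin (m + 1) → ℕ) (hr0 : r 0 = 3) (hrs : ∀ i : Fin m, r i.succ = 5)
    (β : Fin (m + 1) → Fin (m + 1) → ZMod 2) (μ : Fin m → ZMod 2) (h0s : ∀ i : Fin m, β 0 i.succ = μ i)
    (hs0 : ∀ i : Fin m, β i.succ 0 = μ i) (hss : ∀ i j : Fin m, i ≠ j → β i.succ j.succ = 0)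
    (hμ : ∀ i j : Fin m, μ i = 1 → μ j = 1 → i = j) :
    gBitCfgTwo r β = 1 := by
  have h4 : ¬ (∏ i, r i) % 4 = 1 := by rw [prod_star_residues_mod_four r hr0 hrs]; decide
  -- the entries of `RM(−8q∏pᵢ)` on the configuration
  have hE_sN : ∀ a : Fin (m + 1), redeiEntryCfgTwo r β (some a) none = 1 := by
    intro a
    simp only [redeiEntryCfgTwo, if_neg h4, add_zero]
    refine Fin.cases ?_ (fun i => ?_) a
    · rw [hr0]; decide
    · rw [hrs i]; decide
  have hE_Ns : ∀ b : Fin (m + 1), redeiEntryCfgTwo r β none (some b) = 1 := by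
    intro b
    simp only [redeiEntryCfgTwo]
    refine Fin.cases ?_ (fun i => ?_) b
    · rw [hr0]; decide
    · rw [hrs i]; decide
  have hE_0s : ∀ i : Fin m, redeiEntryCfgTwo r β (some 0) (some i.succ) = μ i := by
    intro i
    simp only [redeiEntryCfgTwo, redeiEntryCfg, h0s i, hr0, hrs i]
    simp [chi4Bit]
  have hE_s0 : ∀ i : Fin m, redeiEntryCfgTwo r β (some i.succ) (some 0) = μ i := by
    intro i
    simp only [redeiEntryCfgTwo, redeiEntryCfg, hs0 i, hr0, hrs i]
    simp [chi4Bit]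
  have hE_ss : ∀ i j : Fin m, i ≠ j → redeiEntryCfgTwo r β (some i.succ) (some j.succ) = 0 := by
    intro i j hij
    simp only [redeiEntryCfgTwo, redeiEntryCfg, hss i j hij, hrs i, hrs j]
    decide
  -- `𝔽₂` bookkeeping
  have eq_of_add : ∀ x y : ZMod 2, x + y = 0 → x = y := by decide
  have zmod_cases : ∀ c : ZMod 2, c = 0 ∨ c = 1 := by decide
  unfold gBitCfgTwo
  rw [if_pos]
  unfold redeiCfgTwo
  apply card_ker_rowsum_eq_two
  intro v hv
  -- the row of `pᵢ`: `(v_i + v_2) + μ_i (v_i + v_q) = 0`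
  have key_s : ∀ i : Fin m, (v (some i.succ) + v none) + μ i * (v (some i.succ) + v (some 0)) = 0 := by
    intro i
    have h := hv (some i.succ)
    rw [Fintype.sum_option, Fin.sum_univ_succ, hE_sN, hE_s0, one_mul] at h
    have hrest : ∑ j : Fin m, redeiEntryCfgTwo r β (some i.succ) (some j.succ) *
        (v (some i.succ) + v (some j.succ)) = 0 := by
      refine Finset.sum_eq_zero fun j _ => ?_
      by_cases hji : i = j
      · subst hji; rw [CharTwo.add_self_eq_zero, mul_zero]
      · rw [hE_ss i j hji, zero_mul]
    rw [hrest, add_zero] at h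
    exact h
  -- the row of `q`: `(v_q + v_2) + Σ_j μ_j (v_q + v_j) = 0`
  have key_0 : (v (some 0) + v none) + ∑ j : Fin m, μ j * (v (some 0) + v (some j.succ)) = 0 := by
    have h := hv (some 0)
    rw [Fintype.sum_option, Fin.sum_univ_succ, hE_sN, one_mul, CharTwo.add_self_eq_zero, mul_zero, zero_add] at h
    simp only [hE_0s] at h
    exact h
  -- `v_q = v_2`
  have h0 : v (some 0) = v none := by
    by_cases hex : ∃ i, μ i = 1
    · obtain ⟨i, hi⟩ := hex
      have h := key_s i
      rw [hi, one_mul] at h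
      have : ∀ x y z : ZMod 2, x + y + (x + z) = 0 → z = y := by decide
      exact this _ _ _ h
    · have hμ0 : ∀ i, μ i = 0 := fun i => (zmod_cases (μ i)).resolve_right fun h => hex ⟨i, h⟩
      have h := key_0
      simp only [hμ0, zero_mul, Finset.sum_const_zero, add_zero] at h
      exact eq_of_add _ _ h
  -- `v_i = v_2` for every `pᵢ`
  have hs : ∀ i : Fin m, v (some i.succ) = v none := by
    intro i
    rcases zmod_cases (μ i) with hμi | hμi
    · have h := key_s i
      rw [hμi, zero_mul, add_zero] at h
      exact eq_of_add _ _ h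
    · have h := key_0
      rw [Finset.sum_eq_single i (fun j _ hji => by
        rw [(zmod_cases (μ j)).resolve_right (fun hj => hji (hμ j i hj hμi)), zero_mul])
        (fun hi => absurd (mem_univ i) hi), hμi, one_mul, h0, CharTwo.add_self_eq_zero, zero_add] at h
      exact (eq_of_add _ _ h).symm
  have hall : ∀ a : Option (Fin (m + 1)), v a = v none := by
    rintro (_ | a)
    · rfl
    · exact Fin.cases (motive := fun a => v (some a) = v none) h0 (fun i => hs i) a
  intro a b
  rw [hall a, hall b]

/-! ## §3 The clique of primes `≡ 5 (mod 8)`: `g(p_{i₁}⋯p_{i_s})` is EVEN for every block of `s ≥ 2` of them -/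

/-- **`g(∏pᵢ)` is EVEN for `m ≥ 2` primes `pᵢ ≡ 5 (mod 8)` that are pairwise quadratic residues.** The Rédei matrix `RM(−4∏pᵢ)`
(`redeiCfgEven`: `∏pᵢ ≡ 1 (mod 4)`) has zero rows at the odd primes (`[(p_j/p_i) = −1] = 0`, `[(−4/pᵢ) = −1] = 0`) and the row of `2`
all ones (`[(pⱼ/2) = −1] = 1`): the indicator of two of the `pᵢ` is a non-constant kernel vector, so the kernel has more than `2`
elements and `gBitCfg = 0` (an ideal class of order `4` in `ℚ(√−∏pᵢ)`; modulo Rédei–Reichardt, applied in the companion file).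
[cite: LiMa2008, Thm. 0.4 (p. 280) with Lemma 0.1, Def. 0.2 (p. 279)] [cite: Stevenhagen1995RedeiMatrices, §2 Thm. 1 (l = 2)] -/
theorem gBitCfg_fiveClique_eq_zero (r : Fin m → ℕ) (hr : ∀ i, r i = 5) (β : Fin m → Fin m → ZMod 2)
    (hβ : ∀ a b, a ≠ b → β a b = 0) {i₀ i₁ : Fin m} (hne : i₀ ≠ i₁) :
    gBitCfg r β = 0 := by
  have h4 : (∏ i, r i) % 4 = 1 := by
    have h5 : ∏ i, r i = 5 ^ m := by rw [Finset.prod_congr rfl fun i _ => hr i, Fin.prod_const]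
    rw [h5, Nat.pow_mod]; norm_num
  have hE_ss : ∀ a b : Fin m, a ≠ b → redeiEntryCfgEven r β (some a) (some b) = 0 := by
    intro a b hab
    simp only [redeiEntryCfgEven, redeiEntryCfg, hβ a b hab, hr a, hr b]
    simp [chi4Bit]
  have hE_sN : ∀ a : Fin m, redeiEntryCfgEven r β (some a) none = 0 := by
    intro a; simp only [redeiEntryCfgEven, hr a]; decide
  have hE_Ns : ∀ b : Fin m, redeiEntryCfgEven r β none (some b) = 1 := by
    intro b; simp only [redeiEntryCfgEven, hr b]; decide
  unfold gBitCfg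
  rw [if_pos h4, if_neg]
  unfold redeiCfgEven
  -- the witness: indicator of `{i₀, i₁}` (value `0` at the prime `2`)
  refine card_ker_rowsum_ne_two (redeiEntryCfgEven r β)
    (fun o => o.elim 0 fun i => if i = i₀ ∨ i = i₁ then 1 else 0) (fun a => ?_)
    (a := none) (b := some i₀) (by simp)
  rcases a with _ | a
  · -- the row of `2`: `Σ_b v_b = v_{i₀} + v_{i₁} = 0`
    rw [Fintype.sum_option, CharTwo.add_self_eq_zero, mul_zero, zero_add]
    simp only [hE_Ns, one_mul, Option.elim, zero_add]
    rw [Finset.sum_boole]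
    have hfilter : (univ.filter fun i : Fin m => i = i₀ ∨ i = i₁) = {i₀, i₁} := by
      ext i; simp
    rw [hfilter, Finset.card_pair hne]
    decide
  · -- the row of `p_a`: every entry vanishes (or meets `v_a + v_a = 0`)
    rw [Fintype.sum_option, hE_sN, zero_mul, zero_add]
    refine Finset.sum_eq_zero fun b _ => ?_
    by_cases hab : a = b
    · subst hab; rw [CharTwo.add_self_eq_zero, mul_zero]
    · rw [hE_ss a b hab, zero_mul]

end Star

end ThetaDescent

end Summit.BirchSwinnertonDyer.Rank1Residual.P2

end
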